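import Mathlib.Topology.Baire.Lemmas
import Mathlib.Topology.Baire.LocallyCompactRegular
import Mathlib.Topology.Algebra.OpenSubgroup
import Mathlib.Tactic.Group
import Literature.AnabelianGeometry.SemiGraphs.TemperedGroups
import HarnessLib

/-!
# Tempered groups: compact subgroups of a completion that lie inside the tempered group

Mochizuki, *Semi-graphs of anabelioids*, Publ. RIMS **42** (2006), §3 Def. 3.1 (i) p. 33 (tempered
groups, the tree's `IsTempered`: `Π = lim_N Π/N` over open normal subgroups with countable discrete
quotients) [cite: MochizukiSemiAnbd2006, Def 3.1(i) p.33]; used at [IUTchI] §2 p. 45 (proof of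
Prop. 2.1: "Since `Λ`, `γ·Λ·γ⁻¹` are compact subgroups of `Π^tp_𝔾` …", where `γ ∈ Π̂_𝔾` and only
`γ·Λ·γ⁻¹ ⊆ Π^tp_𝔾` is known — compactness of `γ·Λ·γ⁻¹` for the TEMPERED topology is used silently;
`Π^tp_𝔾 ↪ Π̂_𝔾` is a continuous injection, not an embedding).  PROOF-ONLY file (no definitions),
Mathlib + `TemperedGroups.lean`; written by the [IUTchI] §2 discharge seat abc-iut-L5-t11 and filed
in `SemiGraphs/` for namespace alignment with `IsTempered` (courtesy notice to abc-iut-L3-lead).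

* `isOpen_of_isClosed_of_countable_quotient`, `finiteIndex_of_isClosed_of_countable_quotient` —
  Baire: in a compact group a closed subgroup with countably many cosets is open, of finite index;
* `finite_image_mk_comap` — for an injective homomorphism `ι : T → P` into a topological group, a
  compact subgroup `K ⊆ P` inside `ι(T)` and a subgroup `N ⊆ T` of countable index that is closed
  for the topology induced from `P`, the image of `ι⁻¹(K)` in `T/N` is finite;
* `IsTempered.isCompact_of_finite_image` — in a tempered group, a closed subset with finite images
  in a cofinal family of the discrete quotients `T/N` is compact (ultrafilters + field `complete`);
* `IsTempered.isCompact_comap` — (A0) of the [IUTchI] Prop. 2.1 companion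
  (`IUT/HodgeTheaters/TemperedCoveringsProTree.lean`): for `T` tempered, `ι : T ↪ P` continuous
  injective into a Hausdorff group, and (RF) "open normal subgroups closed for the topology induced
  from `P` are cofinal", every compact subgroup of `P` inside `ι(T)` pulls back to a compact
  subgroup of `T`.  For `Π^tp_𝔾 = lim_i Gal(𝔾_{∞,i}/𝔾) ↪ Π̂_𝔾` ([SemiAnbd] p. 38, [IUTchI] p. 44)
  (RF) says the virtually free groups `Gal(𝔾_{∞,i}/𝔾)` are residually-`Σ̂` — residual finiteness
  when `Σ̂ = 𝔓𝔯𝔦𝔪𝔢𝔰`; for general `Σ̂` an input the instantiation must supply (flagged, not assumed);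
* `IsTempered.t2Space` — tempered groups are Hausdorff.

No statement of either paper is strengthened; nothing here bears on [IUTchIII] Cor. 3.12.
-/

namespace Literature.AnabelianGeometry.SemiGraphs

open Pointwise Filter
open _root_.Topology

/-! ### A.1  Baire: closed subgroups of countable index in a compact group are open -/

section CountableIndex

variable {K : Type*} [Group K] [TopologicalSpace K] [IsTopologicalGroup K]
  [CompactSpace K]

/-- **Baire.**  In a compact topological group, a closed subgroup with countably many (left) cosets
is open: the cosets are countably many closed sets covering the group, so one of them — hence the
subgroup — has an interior point.  (Folklore; it is the Baire step of the compactness assertion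
left implicit at [IUTchI] p. 45, "Since `Λ`, `γ·Λ·γ⁻¹` are compact subgroups of `Π^tp_𝔾`".)
[cite: Mochizuki2012, Prop 2.1 p.45] -/
theorem isOpen_of_isClosed_of_countable_quotient (S : Subgroup K)
    (hS : IsClosed (S : Set K)) (hc : Countable (K ⧸ S)) : IsOpen (S : Set K) := by
  have hcl : ∀ q : K ⧸ S, IsClosed ((QuotientGroup.mk : K → K ⧸ S) ⁻¹' {q}) := by
    intro q
    obtain ⟨g, rfl⟩ := QuotientGroup.mk_surjective q
    have : ((QuotientGroup.mk : K → K ⧸ S) ⁻¹' {(g : K ⧸ S)}) =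
        (fun k => g⁻¹ * k) ⁻¹' (S : Set K) := by
      ext k
      simp only [Set.mem_preimage, Set.mem_singleton_iff, SetLike.mem_coe]
      rw [eq_comm, QuotientGroup.eq]
    rw [this]
    exact hS.preimage (by fun_prop)
  have hcov : ⋃ q : K ⧸ S, ((QuotientGroup.mk : K → K ⧸ S) ⁻¹' {q}) = Set.univ := by
    ext k
    simp only [Set.mem_iUnion, Set.mem_preimage, Set.mem_singleton_iff, Set.mem_univ, iff_true]
    exact ⟨_, rfl⟩
  obtain ⟨q, x, hx⟩ := nonempty_interior_of_iUnion_of_closed hcl hcov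
  have hxq : (QuotientGroup.mk x : K ⧸ S) = q := by
    have := interior_subset hx
    simpa using this
  have hmem : ((QuotientGroup.mk : K → K ⧸ S) ⁻¹' {q}) ∈ 𝓝 x := mem_interior_iff_mem_nhds.mp hx
  have h1 : (fun k : K => x * k) ⁻¹' ((QuotientGroup.mk : K → K ⧸ S) ⁻¹' {q}) ∈ 𝓝 (1 : K) := by
    have hcont : Continuous fun k : K => x * k := by fun_prop
    exact hcont.continuousAt.preimage_mem_nhds (by simpa using hmem)
  refine S.isOpen_of_mem_nhds (g := 1) (Filter.mem_of_superset h1 ?_)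
  intro k hk
  simp only [Set.mem_preimage, Set.mem_singleton_iff] at hk
  rw [← hxq, QuotientGroup.eq] at hk
  have : (x * k)⁻¹ * x = k⁻¹ := by group
  rw [this] at hk
  simpa using hk

/-- In a compact topological group, a closed subgroup with countably many cosets has finite index
(it is open, `isOpen_of_isClosed_of_countable_quotient`; folklore, used at [IUTchI] p. 45 as above).
[cite: Mochizuki2012, Prop 2.1 p.45] -/
theorem finiteIndex_of_isClosed_of_countable_quotient (S : Subgroup K)
    (hS : IsClosed (S : Set K)) (hc : Countable (K ⧸ S)) : S.FiniteIndex := by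
  haveI := Subgroup.quotient_finite_of_isOpen S (isOpen_of_isClosed_of_countable_quotient S hS hc)
  exact Subgroup.finiteIndex_of_finite_quotient

end CountableIndex

/-! ### A.2  Compact subgroups of `P` lying in the image of `ι : T → P` have finite images in the
countable discrete quotients `T ⧸ N` that are closed for the topology induced from `P` -/

section FiniteImage

variable {T : Type*} [Group T] {P : Type*} [Group P] [TopologicalSpace P] [IsTopologicalGroup P]
  (ι : T →* P) (hιi : Function.Injective ι)

include hιi in
/-- **Finite images.**  Let `ι : T → P` be an injective homomorphism into a topological group, `K ⊆ P`
a compact subgroup contained in `ι(T)`, and `N ⊆ T` a subgroup with `T/N` countable which is closed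
for the topology induced from `P` (`ι⁻¹(closure ι(N)) ⊆ N`).  Then `ι⁻¹(K)` has finite image in
`T/N`.  Proof: `K ∩ closure ι(N)` is a closed subgroup of the compact group `K` whose coset space
injects into `T/N`, hence is countable; by Baire it has finite index.  This is the group-theoretic
core of the compactness assertion implicit in [IUTchI] p. 45 "Since `Λ`, `γ·Λ·γ⁻¹` are compact
subgroups of `Π^tp_𝔾`". [cite: Mochizuki2012, Prop 2.1 p.45] -/
theorem finite_image_mk_comap (N : Subgroup T) (hNc : Countable (T ⧸ N))
    (hRF : ((N.map ι).topologicalClosure).comap ι ≤ N)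
    (K : Subgroup P) (hK : IsCompact (K : Set P)) (hKr : K ≤ ι.range) :
    ((QuotientGroup.mk : T → T ⧸ N) '' ((K.comap ι : Subgroup T) : Set T)).Finite := by
  classical
  -- the closure `C` of `ι(N)` and its trace `S` on the compact group `K`
  set C : Subgroup P := (N.map ι).topologicalClosure with hCdef
  haveI : CompactSpace K := isCompact_iff_compactSpace.mp hK
  let S : Subgroup K := C.subgroupOf K
  have hSclosed : IsClosed (S : Set K) := by
    have : (S : Set K) = ((↑) : K → P) ⁻¹' (C : Set P) := rfl
    rw [this]
    exact (Subgroup.isClosed_topologicalClosure _).preimage continuous_subtype_val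
  -- a preimage function `t : K → T`, `ι (t k) = k`
  have hex : ∀ k : K, ∃ t : T, ι t = (k : P) := fun k => hKr k.2
  choose t ht using hex
  -- `k₁ ≡ k₂ (mod S)` iff `t k₁ ≡ t k₂ (mod N)`
  have key : ∀ k₁ k₂ : K, (t k₁)⁻¹ * t k₂ ∈ N ↔ k₁⁻¹ * k₂ ∈ S := by
    intro k₁ k₂
    constructor
    · intro h
      change ((k₁⁻¹ * k₂ : K) : P) ∈ C
      have : ((k₁⁻¹ * k₂ : K) : P) = ι ((t k₁)⁻¹ * t k₂) := by
        simp only [Subgroup.coe_mul, Subgroup.coe_inv, map_mul, map_inv, ht]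
      rw [this]
      exact Subgroup.le_topologicalClosure _ (Subgroup.mem_map_of_mem ι h)
    · intro h
      apply hRF
      rw [Subgroup.mem_comap]
      have : ι ((t k₁)⁻¹ * t k₂) = ((k₁⁻¹ * k₂ : K) : P) := by
        simp only [Subgroup.coe_mul, Subgroup.coe_inv, map_mul, map_inv, ht]
      rw [this]
      exact h
  -- the injection `K ⧸ S ↪ T ⧸ N`
  let ψ : K ⧸ S → T ⧸ N := Quotient.lift (fun k => (QuotientGroup.mk (t k) : T ⧸ N)) (by
    intro a b hab
    have hab' : a⁻¹ * b ∈ S := QuotientGroup.leftRel_apply.mp hab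
    exact QuotientGroup.eq.mpr ((key a b).mpr hab'))
  have hψ : Function.Injective ψ := by
    intro q₁ q₂ h
    induction q₁ using Quotient.inductionOn with
    | h a =>
      induction q₂ using Quotient.inductionOn with
      | h b =>
        change (QuotientGroup.mk (t a) : T ⧸ N) = QuotientGroup.mk (t b) at h
        exact Quotient.sound (QuotientGroup.leftRel_apply.mpr ((key a b).mp (QuotientGroup.eq.mp h)))
  haveI : Countable (K ⧸ S) := hψ.countable
  -- Baire: `S` is open, hence of finite index, in the compact group `K`
  haveI : S.FiniteIndex := finiteIndex_of_isClosed_of_countable_quotient S hSclosed inferInstance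
  haveI : Finite (K ⧸ S) := Subgroup.finite_quotient_of_finiteIndex
  -- the image of `ι⁻¹(K)` in `T ⧸ N` lies in the (finite) range of `ψ`
  refine (Set.finite_range ψ).subset ?_
  rintro _ ⟨h, hh, rfl⟩
  have hk : ι h ∈ K := hh
  refine ⟨Quotient.mk _ ⟨ι h, hk⟩, ?_⟩
  change (QuotientGroup.mk (t ⟨ι h, hk⟩) : T ⧸ N) = QuotientGroup.mk h
  congr 1
  exact hιi (ht ⟨ι h, hk⟩)

end FiniteImage

/-! ### A.3  A compactness criterion in tempered groups -/

section Compactness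

variable {T : Type*} [Group T] [TopologicalSpace T] [IsTopologicalGroup T]

/-- **Compactness criterion in a tempered group** ([SemiAnbd] Def. 3.1 (i): `T = lim_N T/N` over
its open normal subgroups, countable discrete quotients): a closed subset `H ⊆ T` whose image in
`T/N` is finite for a cofinal family of open normal subgroups `N` is compact.  Proof by
ultrafilters: an ultrafilter on `H` contains exactly one coset of every open normal `N`; these
cosets are compatible, so by completeness (field `complete` of `IsTempered`) they are the cosets of
one `g ∈ T`, to which the ultrafilter converges; `g ∈ H` as `H` is closed.
[cite: MochizukiSemiAnbd2006, Def 3.1(i) p.33] -/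
theorem IsTempered.isCompact_of_finite_image (hT : IsTempered T) {H : Set T}
    (hH : IsClosed H)
    (hfin : ∀ U ∈ 𝓝 (1 : T), ∃ N : OpenNormalSubgroup T, (N : Set T) ⊆ U ∧
      ((QuotientGroup.mk : T → T ⧸ N.toSubgroup) '' H).Finite) :
    IsCompact H := by
  classical
  rw [isCompact_iff_ultrafilter_le_nhds]
  intro 𝒰 h𝒰
  have hH𝒰 : H ∈ (𝒰 : Filter T) := Filter.le_principal_iff.mp h𝒰
  -- the fibres of `T → T ⧸ N`
  let fib : (N : OpenNormalSubgroup T) → T ⧸ N.toSubgroup → Set T := fun N c =>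
    (QuotientGroup.mk : T → T ⧸ N.toSubgroup) ⁻¹' {c}
  have fib_mono : ∀ (N M : OpenNormalSubgroup T), (N : Set T) ⊆ M → ∀ g : T,
      fib N (g : T ⧸ N.toSubgroup) ⊆ fib M (g : T ⧸ M.toSubgroup) := by
    intro N M hNM g s hs
    simp only [fib, Set.mem_preimage, Set.mem_singleton_iff] at hs ⊢
    rw [QuotientGroup.eq] at hs ⊢
    exact hNM hs
  -- (1) for every open normal `N`, some fibre belongs to `𝒰`
  have claim1 : ∀ N : OpenNormalSubgroup T, ∃ c : T ⧸ N.toSubgroup, fib N c ∈ (𝒰 : Filter T) := by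
    intro N
    obtain ⟨N', hN'N, hfinN'⟩ := hfin (N : Set T) N.toOpenSubgroup.mem_nhds_one
    have hcover : H ⊆ ⋃ c ∈ (QuotientGroup.mk : T → T ⧸ N'.toSubgroup) '' H, fib N' c := by
      intro h hh
      exact Set.mem_biUnion ⟨h, hh, rfl⟩ rfl
    obtain ⟨c, -, hc𝒰⟩ := (Ultrafilter.finite_biUnion_mem_iff hfinN').mp
      (Filter.mem_of_superset hH𝒰 hcover)
    obtain ⟨g, rfl⟩ := QuotientGroup.mk_surjective c
    exact ⟨(g : T ⧸ N.toSubgroup), Filter.mem_of_superset hc𝒰 (fib_mono N' N hN'N g)⟩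
  -- (2) at most one fibre of each `N` belongs to `𝒰`
  have uniq : ∀ (N : OpenNormalSubgroup T) (c c' : T ⧸ N.toSubgroup),
      fib N c ∈ (𝒰 : Filter T) → fib N c' ∈ (𝒰 : Filter T) → c = c' := by
    intro N c c' hc hc'
    obtain ⟨s, hs⟩ := Filter.nonempty_of_mem (Filter.inter_mem hc hc')
    exact hs.1.symm.trans hs.2
  choose x hx using claim1
  -- (3) completeness of the tempered group: the fibres in `𝒰` are the cosets of one element `g`
  obtain ⟨g, hg⟩ := hT.complete x (by
    intro N M hNM s hxN
    apply uniq M _ _ (hx M)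
    have hmem : fib N (s : T ⧸ N.toSubgroup) ∈ (𝒰 : Filter T) := hxN ▸ hx N
    exact Filter.mem_of_superset hmem (fib_mono N M (fun a ha => hNM ha) s))
  -- (4) `𝒰` converges to `g`
  have hle : (𝒰 : Filter T) ≤ 𝓝 g := by
    intro U hU
    have hU1 : (fun s => g * s) ⁻¹' U ∈ 𝓝 (1 : T) :=
      (continuous_const_mul g).continuousAt.preimage_mem_nhds (by simpa using hU)
    obtain ⟨N, -, hNU⟩ := hT.basis _ hU1
    have hmem : fib N (g : T ⧸ N.toSubgroup) ∈ (𝒰 : Filter T) := hg N ▸ hx N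
    refine Filter.mem_of_superset hmem ?_
    intro s hs
    simp only [fib, Set.mem_preimage, Set.mem_singleton_iff] at hs
    have h1 : g⁻¹ * s ∈ N.toSubgroup := by
      have := N.toSubgroup.inv_mem (QuotientGroup.eq.mp hs)
      simpa using this
    simpa using hNU h1
  -- (5) `g ∈ H` since `H` is closed
  refine ⟨g, ?_, hle⟩
  rw [← hH.closure_eq, mem_closure_iff_ultrafilter]
  exact ⟨𝒰, hH𝒰, hle⟩


/-- A tempered group is Hausdorff (open normal subgroups separate points: field `separated` of
`IsTempered`; cf. `ProfiniteSemiGraph.TemperedPiChart.t2Space` for charts).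
[cite: MochizukiSemiAnbd2006, Def 3.1(i) p.33] -/
theorem IsTempered.t2Space (hT : IsTempered T) : T2Space T := by
  apply IsTopologicalGroup.t2Space_of_one_sep
  intro g hg
  obtain ⟨N, hN⟩ := hT.separated g hg
  exact ⟨N, N.isOpen.mem_nhds N.one_mem, hN⟩

variable {P : Type*} [Group P] [TopologicalSpace P] [IsTopologicalGroup P] [T2Space P]
  (ι : T →* P) (hι : Continuous ι) (hιi : Function.Injective ι)

include hι hιi in
/-- **(A0)**  Let `T` be a tempered group ([SemiAnbd] Def. 3.1 (i)), `ι : T ↪ P` a continuous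
injective homomorphism into a Hausdorff topological group, and suppose (RF): the open normal
subgroups `N ⊆ T` that are closed for the topology induced from `P` (`ι⁻¹(closure ι(N)) ⊆ N`) are
cofinal among the neighbourhoods of `1`.  Then for every compact subgroup `K ⊆ P` contained in
`ι(T)`, the subgroup `ι⁻¹(K) ⊆ T` is compact.  For `Π^tp_𝔾 ↪ Π̂_𝔾` ([IUTchI] §2 p. 44) with the
kernels `N_i` of `Π^tp_𝔾 ↠ Gal(𝔾_{∞,i}/𝔾)` ([SemiAnbd] p. 38), (RF) says that the virtually free
groups `Gal(𝔾_{∞,i}/𝔾)` are residually-`Σ̂` (automatic when `Σ̂ = 𝔓𝔯𝔦𝔪𝔢𝔰`).  This is the step left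
implicit in "Since `Λ`, `γ·Λ·γ⁻¹` are compact subgroups of `Π^tp_𝔾`" ([IUTchI] p. 45).
[cite: MochizukiSemiAnbd2006, Def 3.1(i) p.33] -/
theorem IsTempered.isCompact_comap (hT : IsTempered T)
    (hRF : ∀ U ∈ 𝓝 (1 : T), ∃ N : OpenNormalSubgroup T, (N : Set T) ⊆ U ∧
      ((N.toSubgroup.map ι).topologicalClosure).comap ι ≤ N.toSubgroup)
    (K : Subgroup P) (hK : IsCompact (K : Set P)) (hKr : K ≤ ι.range) :
    IsCompact ((K.comap ι : Subgroup T) : Set T) := by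
  apply hT.isCompact_of_finite_image
  · rw [Subgroup.coe_comap]
    exact hK.isClosed.preimage hι
  · intro U hU
    obtain ⟨N, hNU, hNRF⟩ := hRF U hU
    exact ⟨N, hNU, finite_image_mk_comap ι hιi N.toSubgroup
      (hT.countable_quotient _ N.toOpenSubgroup.isOpen) hNRF K hK hKr⟩

end Compactness

end Literature.AnabelianGeometry.SemiGraphs
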